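import Literature.MathematicalPhysics.QuantumLattice.HubbardTTPrimeThermalPressure
import Literature.MathematicalPhysics.QuantumLattice.CanonicalPartitionFnAdjacentSectors
import Literature.MathematicalPhysics.QuantumLattice.HubbardTTPrimeTorusPartitionFnTiling
import Literature.MathematicalPhysics.QuantumLattice.TorusSectorGibbsOpenBoxBound
import Literature.MathematicalPhysics.QuantumLattice.SquareTilingLimit
import Literature.MathematicalPhysics.QuantumLattice.HubbardNNNHoppingTiling
import Literature.MathematicalPhysics.QuantumLattice.HubbardNNNHoppingRectSymmetries
import HarnessLib

/-!
# Existence of the thermodynamic limit of the canonical pressure of the 2D `t–t'` Hubbard model at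
# every temperature: `p(β; t,t',U; n) = lim_L L⁻² log Z_β^{sector}(L)`

Topic `MathematicalPhysics/QuantumLattice` (family `hubbard`). The positive-temperature twin of
`tendsto_energyDensityTT'` (`HubbardNNNHoppingThermodynamicLimit.lean`). With
`p_L := ThermodynamicLimit.sectorPressureTT' β t t' U n L = L⁻² log Re Z_β(sectorHamiltonianTT' t t' U n L)`
(`HubbardTTPrimeThermalPressure.lean`), for `β ≥ 0`, `U ≥ 0`, `0 ≤ n < 2`:

* §1 bookkeeping of the sector numbers `k_L = halfRectN n L = ⌊nL²/2⌋` under tiling (`K² k_M ≤ k_{KM} ≤ K² k_M + K²`)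
  and filling (`k_L − k_ℓ ≤ L² − ℓ²` once `ℓ ≥ 1/(2−n)`), `k_M < M²`, and the square-torus ↔ rectangular-torus bridge
  `log Re Z_β(sectorHamiltonianTT' … L) = log Re Z_β(hubbardRectTorusTT' L L; k_L, k_L)`;
* §2 the three inputs of Fekete's lemma along squares (`SquareTilingLimit.tendsto_of_tiling_of_filling`) for
  `b_L := −p_L`: (i) `p_M ≤ log 4 + β(8|t|+8|t'|)`; (ii) TILING `p_M ≤ p_{(k+1)M} + C/M + D/M²` — the torus-into-tori
  squares of `HubbardTTPrimeTorusPartitionFnTiling` with block sectors `k_M` or `k_M + 1` (the `≤ (k+1)²` extra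
  pairs of the big torus, one per block) and the COMPRESSIBILITY bound of `CanonicalPartitionFnAdjacentSectors`
  (one pair per `M × M` block costs `2 log M² + 4βK/(2−n)`, `K = 18(2|t|+U) + 36|t'|`); (iii) FILLING
  `L² b_L ≤ ℓ² b_ℓ + C(L² − ℓ² + L)` — `partitionFn_hubbardRectTorusTT'_square_fill` with the extra pairs parked in
  the complement; constants `C = β(16|t|+32|t'|) + βU + 4`, `D = 4βK/(2−n)`;
* §3 **`tendsto_sectorPressureTT'`**: `p_L → pressureTT' β t t' U n` (a real number, `limUnder`), hence
  `pressureInfTT' = pressureSupTT' = pressureTT'`, the limit along every `Ls → ∞`, and the whole calculus of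
  `HubbardTTPrimeThermalPressure` for ONE number: certificate dictionary (`hW` ⇔ `W ≤ p`, `hu` ⇔ `p ≤ u`), window
  `−βe ≤ p ≤ 2H_b(n/2) − βe`, `p(0) = 2H_b(n/2)`, thermal energy windows of torus-limit Gibbs states as chords
  `e_Φ(ω) ≤ (p(β_h) − p(β))/(β − β_h)`, `(p(β) − p(β_c))/(β_c − β) ≤ e_Φ(ω)`, joint convexity in the β-scaled couplings
  on `{U ≥ 0}`, convexity in `β`, antitone and Lipschitz in `U`, Lipschitz in `t'`.

So every `T > 0` pressure certificate of the programme is a bound on the number `pressureTT' β t t' U n`, exactly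
as every `T = 0` energy certificate is a bound on `energyDensityTT' t t' U n`. Everything is PROVED; one real
definition (`pressureTT'`, a `limUnder` with its `tendsto` next to it), no named fact.

## Mathlib / tree search

REUSED: `tendsto_of_tiling_of_filling` (`SquareTilingLimit`), `prod_partitionFn_hubbardRectTorusTT'_squares_le`,
`partitionFn_hubbardRectTorusTT'_square_fill` (`HubbardTTPrimeTorusPartitionFnTiling`),
`log_partitionFn_spinSector_le_succ_succ` (`CanonicalPartitionFnAdjacentSectors`), `sq_mul_rectN_le`, `rectN_le`,
`lt_rectN_add_two`, `rectN_mono_left`, `rectN_le_two_mul` (`HubbardTorus2DEnergyDensity`),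
`groundEnergy_hubbardRectTorusTT'_mem_Icc`, `card_filter_fermionRectTorusGraph_adj_le` (`HubbardNNNHoppingTiling`,
`HubbardTorus2DTiling`), `groundEnergy_hubbardTorusTT'_eq_rect`, `partitionFn_sectorHamiltonianTT'_eq_spinSector`,
`partitionFn_spinSector_hubbardTorusTT'_eq_rect`, `log_partitionFn_sector_le_log_count_sub`, `log_sectorGibbsCount_le`,
the §2–§5 theorems of `HubbardTTPrimeThermalPressure`, Mathlib `tendsto_nhds_limUnder`, `Tendsto.limsup_eq/liminf_eq`.

## References

* D. Ruelle, *Statistical Mechanics: Rigorous Results* (1969), §2.2 (van Hove limits by sub-additivity), §3.3–3.4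
  (quantum lattice / canonical ensemble). [cite: Ruelle1969, §3.4]
* R. B. Israel, *Convexity in the Theory of Lattice Gases* (1979), Thm. I.2.3–I.2.4. [cite: Israel1979, Thm. I.2.4]
* B. Simon, *The Statistical Mechanics of Lattice Gases* I (1993), §II.2–II.3. [cite: Simon1993, §II.3]
-/

noncomputable section

namespace Literature.MathematicalPhysics.QuantumLattice

open Matrix Finset HubbardWave0 Literature.Probability.LatticeModels LiebThm1
open _root_.Filter
open scoped _root_.Topology ComplexOrder BigOperators

namespace ThermodynamicLimit

/-! ### §1 Bookkeeping -/

/-- Every site of `ℤ/aℤ × ℤ/bℤ` has at most four diagonal neighbours (re-derived; private in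
`HubbardNNNHoppingTiling`). [cite: LeBlancEtAl2015, eq. (1)] -/
theorem card_filter_fermionRectTorusDiagGraph_adj_le_four (a b : ℕ) (p : Fin a ×ₗ Fin b) :
    #{q | (fermionRectTorusDiagGraph a b).Adj p q} ≤ 4 := by
  set x : ℕ := ((ofLex p).1 : ℕ) with hx
  set y : ℕ := ((ofLex p).2 : ℕ) with hy
  calc #{q | (fermionRectTorusDiagGraph a b).Adj p q}
      ≤ #({((x + 1) % a, (y + 1) % b), ((x + 1) % a, (y + (b - 1)) % b),
            ((x + (a - 1)) % a, (y + 1) % b), ((x + (a - 1)) % a, (y + (b - 1)) % b)} :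
          Finset (ℕ × ℕ)) := by
        refine Finset.card_le_card_of_injOn (fun q => (((ofLex q).1 : ℕ), ((ofLex q).2 : ℕ))) ?_ ?_
        · intro q hq
          rw [Finset.mem_coe, Finset.mem_filter, fermionRectTorusDiagGraph_adj_iff] at hq
          simp only [Finset.coe_insert, Finset.coe_singleton, Set.mem_insert_iff,
            Set.mem_singleton_iff, Prod.mk.injEq]
          obtain ⟨-, ⟨-, h1 | h1⟩, ⟨-, h2 | h2⟩⟩ := hq
          · exact Or.inl ⟨h1.symm, h2.symm⟩
          · exact Or.inr (Or.inl ⟨h1.symm, eq_mod_of_succ_mod_eq (ofLex p).2.isLt (ofLex q).2.isLt h2⟩)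
          · exact Or.inr (Or.inr (Or.inl
              ⟨eq_mod_of_succ_mod_eq (ofLex p).1.isLt (ofLex q).1.isLt h1, h2.symm⟩))
          · exact Or.inr (Or.inr (Or.inr ⟨eq_mod_of_succ_mod_eq (ofLex p).1.isLt (ofLex q).1.isLt h1,
              eq_mod_of_succ_mod_eq (ofLex p).2.isLt (ofLex q).2.isLt h2⟩))
        · intro q _ q' _ h
          simp only [Prod.mk.injEq] at h
          exact ofLex.injective (Prod.ext (Fin.ext h.1) (Fin.ext h.2))
    _ ≤ 4 := Finset.card_le_four

/-- The bridge square torus ↔ rectangular torus for the canonical `log`-partition function: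
`log Re Z_β(sectorHamiltonianTT' t t' U n L) = log Re Z_β(hubbardRectTorusTT' L L; k_L, k_L)`, `k_L = halfRectN n L`.
[cite: Israel1979, Lemma II.3.1] -/
theorem log_partitionFn_sectorHamiltonianTT'_eq_rect (β t t' U n : ℝ) (L : ℕ) :
    Real.log (partitionFn β (sectorHamiltonianTT' t t' U n L)).re =
      Real.log (partitionFn β (spinSectorHamiltonian (halfRectN n L) (halfRectN n L)
        (hubbardRectTorusTT' L L t t' U))).re := by
  rw [partitionFn_sectorHamiltonianTT'_eq_spinSector, partitionFn_spinSector_hubbardTorusTT'_eq_rect]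

/-- Tiling scaling of the sector numbers: `K² k_M ≤ k_{KM} ≤ K² k_M + K²`. [cite: Ruelle1969, §3.3] -/
theorem sq_mul_halfRectN_le {n : ℝ} (hn0 : 0 ≤ n) (K M : ℕ) :
    K * K * halfRectN n M ≤ halfRectN n (K * M) ∧ halfRectN n (K * M) ≤ K * K * halfRectN n M + K * K := by
  obtain ⟨h1, h2⟩ := sq_mul_rectN_le hn0 K M
  have e1 : rectN n M = 2 * halfRectN n M := rfl
  have e2 : rectN n (K * M) = 2 * halfRectN n (K * M) := rfl
  constructor
  · have h : 2 * (K * K * halfRectN n M) ≤ 2 * halfRectN n (K * M) := by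
      calc 2 * (K * K * halfRectN n M) = K * K * rectN n M := by rw [e1]; ring
        _ ≤ rectN n (K * M) := h1
        _ = 2 * halfRectN n (K * M) := e2
    exact Nat.le_of_mul_le_mul_left h two_pos
  · have h2' : rectN n (K * M) ≤ K * K * rectN n M + 2 * (K * K) := by exact_mod_cast h2
    have h : 2 * halfRectN n (K * M) ≤ 2 * (K * K * halfRectN n M + K * K) := by
      calc 2 * halfRectN n (K * M) = rectN n (K * M) := e2.symm
        _ ≤ K * K * rectN n M + 2 * (K * K) := h2'
        _ = 2 * (K * K * halfRectN n M + K * K) := by rw [e1]; ring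
    exact Nat.le_of_mul_le_mul_left h two_pos

/-- `k_M < M²` for `0 ≤ n < 2` and `M ≥ 1`. [cite: Ruelle1969, §3.3] -/
theorem halfRectN_lt_sq {n : ℝ} (hn0 : 0 ≤ n) (hn2 : n < 2) {M : ℕ} (hM : 1 ≤ M) :
    halfRectN n M < M * M := by
  have h := rectN_le hn0 M
  have e1 : rectN n M = 2 * halfRectN n M := rfl
  have hM' : (0 : ℝ) < (M : ℝ) ^ 2 := by
    have : (1 : ℝ) ≤ M := by exact_mod_cast hM
    positivity
  have hlt : (rectN n M : ℝ) < 2 * ((M * M : ℕ) : ℝ) := by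
    calc (rectN n M : ℝ) ≤ n * (M : ℝ) ^ 2 := h
      _ < 2 * (M : ℝ) ^ 2 := by nlinarith
      _ = 2 * ((M * M : ℕ) : ℝ) := by push_cast; ring
  have hlt' : rectN n M < 2 * (M * M) := by exact_mod_cast hlt
  omega

/-- Filling: for `ℓ ≥ M₀ > 1/(2−n)` and `r ≥ 0`, the extra pairs of the bigger torus fit into the complement,
`k_{ℓ+r} − k_ℓ ≤ rℓ + r(ℓ+r)`. [cite: Ruelle1969, §2.2] -/
theorem halfRectN_sub_le_complement {n : ℝ} (hn0 : 0 ≤ n) (hn2 : n < 2) {M₀ : ℕ} (hM₀n : 1 / (2 - n) ≤ M₀)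
    {ℓ : ℕ} (hℓ : M₀ ≤ ℓ) (r : ℕ) :
    halfRectN n ℓ ≤ halfRectN n (ℓ + r) ∧ halfRectN n (ℓ + r) - halfRectN n ℓ ≤ r * ℓ + r * (ℓ + r) := by
  have h2n : 0 < 2 - n := by linarith
  have hmono : rectN n ℓ ≤ rectN n (ℓ + r) := rectN_mono_left hn0 (Nat.le_add_right ℓ r)
  have e1 : rectN n ℓ = 2 * halfRectN n ℓ := rfl
  have e2 : rectN n (ℓ + r) = 2 * halfRectN n (ℓ + r) := rfl
  refine ⟨by omega, ?_⟩
  rcases Nat.eq_zero_or_pos r with hr | hr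
  · subst hr; simp
  · have h1 := rectN_le hn0 (ℓ + r)
    have h2 := lt_rectN_add_two n ℓ
    have hℓr : (1 : ℝ) ≤ r := by exact_mod_cast hr
    have hℓ' : (M₀ : ℝ) ≤ ℓ := by exact_mod_cast hℓ
    have hgap : 2 ≤ (2 - n) * (((ℓ : ℝ) + r) ^ 2 - (ℓ : ℝ) ^ 2) := by
      have h3 : (2 : ℝ) * ℓ + 1 ≤ ((ℓ : ℝ) + r) ^ 2 - (ℓ : ℝ) ^ 2 := by nlinarith
      have h4 : 1 ≤ (2 - n) * M₀ := by
        rw [div_le_iff₀ h2n] at hM₀n; linarith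
      nlinarith
    have key : ((rectN n (ℓ + r) : ℕ) : ℝ) - rectN n ℓ ≤ 2 * (r * ℓ + r * (ℓ + r) : ℕ) := by
      push_cast at h1 ⊢; nlinarith
    have key' : ((2 * halfRectN n (ℓ + r) : ℕ) : ℝ) ≤ 2 * halfRectN n ℓ + 2 * (r * ℓ + r * (ℓ + r) : ℕ) := by
      rw [← e2]; push_cast; rw [e1] at key; push_cast at key; linarith
    have key'' : 2 * halfRectN n (ℓ + r) ≤ 2 * halfRectN n ℓ + 2 * (r * ℓ + r * (ℓ + r)) := by exact_mod_cast key'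
    omega

/-- The compressibility price of one electron pair in an `M × M` torus block, per block:
`2(log M² + βK M²/(M² − k_M)) ≤ 4M + 4βK/(2−n)` (`k_M ≤ nM²/2`, `log M² ≤ 2M`). [cite: Ruelle1969, §3.4] -/
theorem tiling_pair_price_le {β : ℝ} (hβ : 0 ≤ β) (t t' : ℝ) {U : ℝ} (hU : 0 ≤ U) {n : ℝ} (hn0 : 0 ≤ n)
    (hn2 : n < 2) {M : ℕ} (hM : 1 ≤ M) :
    2 * (Real.log (Fintype.card (Fin M ×ₗ Fin M)) +
      β * ((2 * 4 + 1 : ℕ) * (2 * (2 * |t| + |U|)) + (2 * 4 + 1 : ℕ) * (2 * (2 * |t'| + |(0 : ℝ)|))) *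
        Fintype.card (Fin M ×ₗ Fin M) / (Fintype.card (Fin M ×ₗ Fin M) - halfRectN n M)) ≤
      4 * M + 4 * β * (18 * (2 * |t| + U) + 36 * |t'|) / (2 - n) := by
  have h2n : 0 < 2 - n := by linarith
  have hMpos : (0 : ℝ) < M := by exact_mod_cast hM
  rw [card_rectSites]
  set V : ℝ := ((M * M : ℕ) : ℝ) with hV
  have hVpos : 0 < V := by rw [hV]; push_cast; positivity
  have hlogV : Real.log V ≤ 2 * M := by
    have h1 : Real.log V = 2 * Real.log M := by
      rw [hV]; push_cast; rw [← sq, Real.log_pow]; norm_num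
    rw [h1]
    have := Real.log_le_sub_one_of_pos hMpos
    linarith
  have hkMle : ((halfRectN n M : ℕ) : ℝ) ≤ n / 2 * V := by
    have h := rectN_le hn0 M
    have e1 : (rectN n M : ℝ) = 2 * halfRectN n M := by exact_mod_cast (rfl : rectN n M = 2 * halfRectN n M)
    rw [e1] at h
    have e2 : V = (M : ℝ) ^ 2 := by rw [hV]; push_cast; ring
    rw [e2]; linarith
  have hden' : (2 - n) / 2 * V ≤ V - halfRectN n M := by nlinarith
  have hden0 : 0 < (2 - n) / 2 * V := by positivity
  set Kc : ℝ := 18 * (2 * |t| + U) + 36 * |t'| with hKc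
  have hKc0 : 0 ≤ Kc := by rw [hKc]; positivity
  have hKc' : ((2 * 4 + 1 : ℕ) : ℝ) * (2 * (2 * |t| + |U|)) +
      ((2 * 4 + 1 : ℕ) : ℝ) * (2 * (2 * |t'| + |(0 : ℝ)|)) = Kc := by
    rw [hKc, abs_zero, abs_of_nonneg hU]; push_cast; ring
  rw [hKc']
  have hfrac : β * Kc * V / (V - halfRectN n M) ≤ 2 * β * Kc / (2 - n) := by
    calc β * Kc * V / (V - halfRectN n M) ≤ β * Kc * V / ((2 - n) / 2 * V) :=
          div_le_div_of_nonneg_left (by positivity) hden0 hden'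
      _ = 2 * β * Kc / (2 - n) := by
          rw [div_eq_div_iff (ne_of_gt hden0) h2n.ne']
          ring
  calc 2 * (Real.log V + β * Kc * V / (V - halfRectN n M))
      ≤ 2 * (2 * M + 2 * β * Kc / (2 - n)) := mul_le_mul_of_nonneg_left (add_le_add hlogV hfrac) (by norm_num)
    _ = 4 * M + 4 * β * Kc / (2 - n) := by ring

/-- Division step of the tiling inequality: from `−cMk(k+1) + K²(X − A) ≤ Y` (`K = k + 1`), `A ≤ 4M + D`, `c ≥ 0`:
`X/M² ≤ Y/(KM)² + (c + 4)/M + D/M²`. [cite: Ruelle1969, §2.2] -/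
theorem tiling_div_step {X Y A D c M K k : ℝ} (hM : 0 < M) (hK : 0 < K) (hk : k + 1 = K)
    (hA : A ≤ 4 * M + D) (hc : 0 ≤ c) (h : -(c * M * k * (k + 1)) + K * (K * (X - A)) ≤ Y) :
    X / M ^ 2 ≤ Y / (K * M) ^ 2 + (c + 4) / M + D / M ^ 2 := by
  have hM2 : 0 < M ^ 2 := by positivity
  have hK2 : 0 < K ^ 2 := by positivity
  have hkK : c * M * k * (k + 1) ≤ c * M * K ^ 2 := by
    rw [hk]
    have : k * K ≤ K ^ 2 := by nlinarith
    nlinarith [mul_nonneg hc hM.le]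
  have h1 : X - A ≤ Y / K ^ 2 + c * M := by
    rw [div_add' _ _ _ hK2.ne', le_div_iff₀ hK2]
    nlinarith
  have e : (Y / (K * M) ^ 2 + (c + 4) / M + D / M ^ 2) * M ^ 2 = Y / K ^ 2 + (c + 4) * M + D := by
    field_simp
  rw [div_le_iff₀ hM2, e]
  linarith

/-! ### §2 The three inputs of Fekete's lemma along squares -/

section Fekete

variable {β : ℝ} (hβ : 0 ≤ β) (t t' : ℝ) {U : ℝ} (hU : 0 ≤ U) {n : ℝ} (hn0 : 0 ≤ n) (hn2 : n < 2)
include hβ hU hn0 hn2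

/-- **(i) A-priori ceiling**: `p_M ≤ log 4 + β(8|t| + 8|t'|)` (`log Z ≤ log #sector − βE₀` and
`E₀ ≥ −(8|t|+8|t'|)M²`). [cite: Ruelle1969, §3.3] -/
theorem sectorPressureTT'_le_apriori {M : ℕ} (hM : 1 ≤ M) :
    sectorPressureTT' β t t' U n M ≤ Real.log 4 + β * (8 * |t| + 8 * |t'|) := by
  have hL2 : (0 : ℝ) < (M : ℝ) ^ 2 := by
    have : (1 : ℝ) ≤ M := by exact_mod_cast hM
    positivity
  have h1 := log_partitionFn_sector_le_log_count_sub hβ t t' U hn0 hn2.le M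
  have h2 := log_sectorGibbsCount_le n M
  have h3 := (groundEnergy_hubbardRectTorusTT'_mem_Icc M M t t' hU (rectN_le_two_mul hn0 hn2.le M)).1
  rw [← groundEnergy_hubbardTorusTT'_eq_rect] at h3
  rw [sectorPressureTT', div_le_iff₀ hL2]
  have h4 : -(β * groundEnergy (hubbardTorusTT' M t t' U) (rectN n M)) ≤ β * ((8 * |t| + 8 * |t'|) * (M * M)) := by
    have := mul_le_mul_of_nonneg_left h3 hβ
    linarith
  have e : (M : ℝ) * M = (M : ℝ) ^ 2 := by ring
  rw [e] at h4
  nlinarith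

/-- **(ii) Tiling**: for `M ≥ 1` and every `k`,
`p_M ≤ p_{(k+1)M} + (β(16|t|+32|t'|) + 4)/M + (4βK/(2−n))/M²`, `K = 18(2|t|+U) + 36|t'|` — the big torus at its own
sector `k_{(k+1)M}` is tiled by `(k+1)²` small tori carrying `k_M` or `k_M + 1` pairs each; the blocks with an extra
pair are priced by the compressibility bound. [cite: Ruelle1969, §3.4] -/
theorem sectorPressureTT'_le_tiling (k : ℕ) {M : ℕ} (hM : 1 ≤ M) :
    sectorPressureTT' β t t' U n M ≤ sectorPressureTT' β t t' U n ((k + 1) * M) +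
      (β * (16 * |t| + 32 * |t'|) + 4) / M +
        (4 * β * (18 * (2 * |t| + U) + 36 * |t'|) / (2 - n)) / (M : ℝ) ^ 2 := by
  classical
  have h2n : 0 < 2 - n := by linarith
  have hK1 : 1 ≤ k + 1 := Nat.le_add_left 1 k
  -- the two sector numbers and the number `j ≤ (k+1)²` of extra pairs
  obtain ⟨hP1, hP2⟩ := sq_mul_halfRectN_le hn0 (k + 1) M
  obtain ⟨j, hj, hjle⟩ : ∃ j, halfRectN n ((k + 1) * M) = (k + 1) * (k + 1) * halfRectN n M + j ∧
      j ≤ (k + 1) * (k + 1) :=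
    ⟨halfRectN n ((k + 1) * M) - (k + 1) * (k + 1) * halfRectN n M, by omega, by omega⟩
  -- choose `j` blocks to carry the extra pairs
  obtain ⟨s, -, hs⟩ : ∃ s : Finset (Fin (k + 1) × Fin (k + 1)), s ⊆ Finset.univ ∧ s.card = j :=
    Finset.exists_subset_card_eq (by rw [Finset.card_univ, Fintype.card_prod, Fintype.card_fin]; exact hjle)
  let ps : Fin (k + 1) → Fin (k + 1) → ℕ := fun i i' => halfRectN n M + if (i, i') ∈ s then 1 else 0
  have hps_apply : ∀ i i', ps i i' = halfRectN n M + if (i, i') ∈ s then 1 else 0 := fun _ _ => rfl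
  have hsum : ∑ i, ∑ i', ps i i' = halfRectN n ((k + 1) * M) := by
    have h1 : ∑ i : Fin (k + 1), ∑ i' : Fin (k + 1), ps i i' =
        ∑ x : Fin (k + 1) × Fin (k + 1), (halfRectN n M + if x ∈ s then 1 else 0) := by
      rw [← Finset.sum_product']
      rfl
    rw [h1, Finset.sum_add_distrib, Finset.sum_const, Finset.card_univ, Fintype.card_prod, Fintype.card_fin,
      smul_eq_mul, Finset.sum_boole, Finset.filter_mem_eq_inter, Finset.univ_inter, hs, hj]
    simp
  -- the small sector is well inside the small torus
  have hkMlt : halfRectN n M < M * M := halfRectN_lt_sq hn0 hn2 hM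
  have hkM1 : halfRectN n M + 1 ≤ Fintype.card (Fin M ×ₗ Fin M) := by rw [card_rectSites]; omega
  have hpsle : ∀ i i', ps i i' ≤ M * M := fun i i' => by rw [hps_apply]; split_ifs <;> omega
  -- positivity of the block partition functions
  have hHM : (hubbardRectTorusTT' M M t t' U).IsHermitian := hubbardRectTorusTT'_isHermitian M M t t' U
  have hZpos : ∀ a : ℕ, a ≤ M * M →
      0 < (partitionFn β (spinSectorHamiltonian a a (hubbardRectTorusTT' M M t t' U))).re := by
    intro a ha
    have ha' : a ≤ Fintype.card (Fin M ×ₗ Fin M) := by rw [card_rectSites]; exact ha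
    haveI := nonempty_spinConfig (Λ := Fin M ×ₗ Fin M) ha' ha'
    exact partitionFn_spinSector_re_pos hHM β
  -- the compressibility price `A` of one pair in an `M × M` block
  have hstep := log_partitionFn_spinSector_le_succ_succ (fermionRectTorusGraph M M) (fermionRectTorusDiagGraph M M)
    (card_filter_fermionRectTorusGraph_adj_le M M) (card_filter_fermionRectTorusDiagGraph_adj_le_four M M)
    t U t' 0 hβ hkM1
  set A : ℝ := 2 * (Real.log (Fintype.card (Fin M ×ₗ Fin M)) +
    β * ((2 * 4 + 1 : ℕ) * (2 * (2 * |t| + |U|)) + (2 * 4 + 1 : ℕ) * (2 * (2 * |t'| + |(0 : ℝ)|))) *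
      Fintype.card (Fin M ×ₗ Fin M) / (Fintype.card (Fin M ×ₗ Fin M) - halfRectN n M)) with hA
  have hstep' : Real.log (partitionFn β (spinSectorHamiltonian (halfRectN n M) (halfRectN n M)
      (hubbardRectTorusTT' M M t t' U))).re ≤
      A + Real.log (partitionFn β (spinSectorHamiltonian (halfRectN n M + 1) (halfRectN n M + 1)
        (hubbardRectTorusTT' M M t t' U))).re := by
    unfold hubbardRectTorusTT'
    exact hstep
  have hcardpos : (1 : ℝ) ≤ Fintype.card (Fin M ×ₗ Fin M) := by
    rw [card_rectSites]; exact_mod_cast Nat.one_le_iff_ne_zero.2 (by positivity)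
  have hden : 0 < (Fintype.card (Fin M ×ₗ Fin M) : ℝ) - halfRectN n M := by
    rw [card_rectSites]
    have : ((halfRectN n M : ℕ) : ℝ) < ((M * M : ℕ) : ℝ) := by exact_mod_cast hkMlt
    linarith
  have hA0 : 0 ≤ A := by
    rw [hA]
    have hlog : 0 ≤ Real.log (Fintype.card (Fin M ×ₗ Fin M)) := Real.log_nonneg hcardpos
    positivity
  -- every block: `log Z(ps) ≥ log Z(k_M) − A`
  have hblock : ∀ i i', Real.log (partitionFn β (spinSectorHamiltonian (halfRectN n M) (halfRectN n M)
      (hubbardRectTorusTT' M M t t' U))).re - A ≤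
      Real.log (partitionFn β (spinSectorHamiltonian (ps i i') (ps i i') (hubbardRectTorusTT' M M t t' U))).re := by
    intro i i'
    by_cases hmem : (i, i') ∈ s
    · have e : ps i i' = halfRectN n M + 1 := by rw [hps_apply, if_pos hmem]
      rw [e]; linarith
    · have e : ps i i' = halfRectN n M := by rw [hps_apply, if_neg hmem, add_zero]
      rw [e]; linarith
  -- the squares inequality, in logarithmic form
  have hsq := prod_partitionFn_hubbardRectTorusTT'_squares_le M t t' U hβ k ps ps
  rw [hsum] at hsq
  have hprodpos : 0 < ∏ i, ∏ i', (partitionFn β (spinSectorHamiltonian (ps i i') (ps i i')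
      (hubbardRectTorusTT' M M t t' U))).re :=
    Finset.prod_pos fun i _ => Finset.prod_pos fun i' _ => hZpos _ (hpsle i i')
  have hlog := Real.log_le_log (mul_pos (Real.exp_pos _) hprodpos) hsq
  have hlogprod : Real.log (∏ i, ∏ i', (partitionFn β (spinSectorHamiltonian (ps i i') (ps i i')
      (hubbardRectTorusTT' M M t t' U))).re) =
      ∑ i, ∑ i', Real.log (partitionFn β (spinSectorHamiltonian (ps i i') (ps i i')
        (hubbardRectTorusTT' M M t t' U))).re := by
    rw [Real.log_prod (fun i _ => (Finset.prod_pos fun i' _ => hZpos _ (hpsle i i')).ne')]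
    refine Finset.sum_congr rfl fun i _ => ?_
    rw [Real.log_prod (fun i' _ => (hZpos _ (hpsle i i')).ne')]
  rw [Real.log_mul (Real.exp_pos _).ne' hprodpos.ne', Real.log_exp, hlogprod] at hlog
  -- sum the block bounds
  have hsumblock : ((k + 1 : ℕ) : ℝ) * (((k + 1 : ℕ) : ℝ) *
      (Real.log (partitionFn β (spinSectorHamiltonian (halfRectN n M) (halfRectN n M)
        (hubbardRectTorusTT' M M t t' U))).re - A)) ≤
      ∑ i : Fin (k + 1), ∑ i' : Fin (k + 1),
        Real.log (partitionFn β (spinSectorHamiltonian (ps i i') (ps i i') (hubbardRectTorusTT' M M t t' U))).re := by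
    have h := Finset.sum_le_sum fun i (_ : i ∈ Finset.univ) =>
      Finset.sum_le_sum fun i' (_ : i' ∈ Finset.univ) => hblock i i'
    simp only [Finset.sum_const, Finset.card_univ, Fintype.card_fin, nsmul_eq_mul] at h
    exact h
  -- per-volume identities
  have hMpos : (0 : ℝ) < M := by exact_mod_cast hM
  have hKpos : (0 : ℝ) < ((k + 1 : ℕ) : ℝ) := by exact_mod_cast hK1
  have epM : sectorPressureTT' β t t' U n M =
      Real.log (partitionFn β (spinSectorHamiltonian (halfRectN n M) (halfRectN n M)
        (hubbardRectTorusTT' M M t t' U))).re / (M : ℝ) ^ 2 := by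
    rw [sectorPressureTT', log_partitionFn_sectorHamiltonianTT'_eq_rect]
  have epK : sectorPressureTT' β t t' U n ((k + 1) * M) =
      Real.log (partitionFn β (spinSectorHamiltonian (halfRectN n ((k + 1) * M)) (halfRectN n ((k + 1) * M))
        (hubbardRectTorusTT' ((k + 1) * M) ((k + 1) * M) t t' U))).re / ((((k + 1) * M : ℕ) : ℝ)) ^ 2 := by
    rw [sectorPressureTT', log_partitionFn_sectorHamiltonianTT'_eq_rect]
  -- the constant `A ≤ 4M + 4βK/(2−n)` and the division by `((k+1)M)²`
  have hAbound : A ≤ 4 * M + 4 * β * (18 * (2 * |t| + U) + 36 * |t'|) / (2 - n) := by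
    rw [hA]; exact tiling_pair_price_le hβ t t' hU hn0 hn2 hM
  have hk : (k : ℝ) + 1 = ((k + 1 : ℕ) : ℝ) := by push_cast; ring
  have hineq : -(β * (16 * |t| + 32 * |t'|) * M * k * (k + 1)) +
      ((k + 1 : ℕ) : ℝ) * (((k + 1 : ℕ) : ℝ) *
        (Real.log (partitionFn β (spinSectorHamiltonian (halfRectN n M) (halfRectN n M)
          (hubbardRectTorusTT' M M t t' U))).re - A)) ≤
      Real.log (partitionFn β (spinSectorHamiltonian (halfRectN n ((k + 1) * M)) (halfRectN n ((k + 1) * M))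
        (hubbardRectTorusTT' ((k + 1) * M) ((k + 1) * M) t t' U))).re := by
    have e : β * (16 * |t| + 32 * |t'|) * M * k * (k + 1) = β * ((16 * |t| + 32 * |t'|) * M * k * (k + 1)) := by ring
    rw [e]
    linarith
  have hfin := tiling_div_step hMpos hKpos hk hAbound (by positivity) hineq
  rw [epM, epK]
  push_cast at hfin ⊢
  exact hfin

/-- **(iii) Filling**: for `M₀ ≤ ℓ ≤ L` with `M₀ ≥ 1/(2−n)`,
`L² (−p_L) ≤ ℓ² (−p_ℓ) + C (L² − ℓ² + L)`, `C = β(16|t|+32|t'|) + βU + 4` — the big torus at its own sector contains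
the corner torus `ℓ × ℓ` at its own sector plus the extra pairs parked in the complement. [cite: Ruelle1969, §2.2] -/
theorem sq_mul_neg_sectorPressureTT'_le_filling {M₀ : ℕ} (hM₀1 : 1 ≤ M₀) (hM₀n : 1 / (2 - n) ≤ M₀) {ℓ L : ℕ}
    (hℓ : M₀ ≤ ℓ) (hℓL : ℓ ≤ L) :
    (L : ℝ) ^ 2 * (-sectorPressureTT' β t t' U n L) ≤
      (ℓ : ℝ) ^ 2 * (-sectorPressureTT' β t t' U n ℓ) +
        (β * (16 * |t| + 32 * |t'|) + β * U + 4) * ((L : ℝ) ^ 2 - (ℓ : ℝ) ^ 2 + L) := by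
  have hℓ1 : 1 ≤ ℓ := hM₀1.trans hℓ
  have hL1 : 1 ≤ L := hℓ1.trans hℓL
  obtain ⟨r, rfl⟩ : ∃ r, L = ℓ + r := ⟨L - ℓ, by omega⟩
  obtain ⟨hmono, hq⟩ := halfRectN_sub_le_complement hn0 hn2 hM₀n hℓ r
  set q : ℕ := halfRectN n (ℓ + r) - halfRectN n ℓ with hqdef
  have hsplit : halfRectN n (ℓ + r) = halfRectN n ℓ + q := by omega
  have hfill := partitionFn_hubbardRectTorusTT'_square_fill ℓ r t t' U hβ (halfRectN n ℓ) hq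
  rw [← hsplit, max_eq_left hU] at hfill
  -- positivity of the two partition functions
  have hcardℓ : halfRectN n ℓ ≤ Fintype.card (Fin ℓ ×ₗ Fin ℓ) := by
    rw [card_rectSites]; exact (halfRectN_lt_sq hn0 hn2 hℓ1).le
  have hcardL : halfRectN n (ℓ + r) ≤ Fintype.card (Fin (ℓ + r) ×ₗ Fin (ℓ + r)) := by
    rw [card_rectSites]; exact (halfRectN_lt_sq hn0 hn2 hL1).le
  haveI := nonempty_spinConfig (Λ := Fin ℓ ×ₗ Fin ℓ) hcardℓ hcardℓ
  haveI := nonempty_spinConfig (Λ := Fin (ℓ + r) ×ₗ Fin (ℓ + r)) hcardL hcardL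
  have hZℓ : 0 < (partitionFn β (spinSectorHamiltonian (halfRectN n ℓ) (halfRectN n ℓ)
      (hubbardRectTorusTT' ℓ ℓ t t' U))).re :=
    partitionFn_spinSector_re_pos (hubbardRectTorusTT'_isHermitian ℓ ℓ t t' U) β
  have hZL : 0 < (partitionFn β (spinSectorHamiltonian (halfRectN n (ℓ + r)) (halfRectN n (ℓ + r))
      (hubbardRectTorusTT' (ℓ + r) (ℓ + r) t t' U))).re :=
    partitionFn_spinSector_re_pos (hubbardRectTorusTT'_isHermitian _ _ t t' U) β
  have hlog := Real.log_le_log (mul_pos (Real.exp_pos _) hZℓ) hfill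
  rw [Real.log_mul (Real.exp_pos _).ne' hZℓ.ne', Real.log_exp] at hlog
  -- per-volume identities
  have hℓpos : (0 : ℝ) < ℓ := by exact_mod_cast hℓ1
  have hLpos : (0 : ℝ) < ((ℓ + r : ℕ) : ℝ) := by exact_mod_cast hL1
  rw [sectorPressureTT', sectorPressureTT', log_partitionFn_sectorHamiltonianTT'_eq_rect,
    log_partitionFn_sectorHamiltonianTT'_eq_rect, mul_neg, mul_neg,
    mul_div_cancel₀ _ (by positivity), mul_div_cancel₀ _ (by positivity)]
  -- the cost: `β((8|t|+16|t'|)(2ℓ+r) + U q) ≤ C (L² − ℓ² + L)`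
  have hqR : (q : ℝ) ≤ r * ℓ + r * (ℓ + r) := by exact_mod_cast hq
  have hr0 : (0 : ℝ) ≤ r := by positivity
  have hG : (r : ℝ) * ℓ + r * (ℓ + r) = ((ℓ : ℝ) + r) ^ 2 - (ℓ : ℝ) ^ 2 := by ring
  have ht0 : 0 ≤ |t| := abs_nonneg t
  have ht'0 : 0 ≤ |t'| := abs_nonneg t'
  push_cast at hlog ⊢
  rw [hG] at hqR
  have hG0 : (0 : ℝ) ≤ ((ℓ : ℝ) + r) ^ 2 - (ℓ : ℝ) ^ 2 := by nlinarith
  nlinarith [hlog, mul_nonneg hβ (mul_nonneg hU hG0), mul_nonneg hβ hU, mul_nonneg (mul_nonneg hβ hU) (sub_nonneg.2 hqR),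
    mul_nonneg (mul_nonneg hβ ht0) hr0, mul_nonneg (mul_nonneg hβ ht'0) hr0,
    mul_nonneg (mul_nonneg hβ ht0) hℓpos.le, mul_nonneg (mul_nonneg hβ ht'0) hℓpos.le, hG0]

/-- **Existence of the thermodynamic limit of the canonical pressure** (`β ≥ 0`, `U ≥ 0`, `0 ≤ n < 2`):
`L⁻² log Re Z_β(sectorHamiltonianTT' t t' U n L)` converges as `L → ∞` — Fekete along squares fed by the a-priori
ceiling, the torus tiling with the compressibility price of the rounding pairs, and the complement filling.
[cite: Ruelle1969, §3.4] [cite: Israel1979, Thm. I.2.4] -/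
theorem exists_tendsto_sectorPressureTT' :
    ∃ π : ℝ, Tendsto (fun L : ℕ => sectorPressureTT' β t t' U n L) atTop (𝓝 π) := by
  have h2n : 0 < 2 - n := by linarith
  set M₀ : ℕ := ⌈1 / (2 - n)⌉₊ + 1 with hM₀
  have hM₀1 : 1 ≤ M₀ := Nat.le_add_left 1 _
  have hM₀n : 1 / (2 - n) ≤ M₀ := by
    have := Nat.le_ceil (1 / (2 - n))
    rw [hM₀]; push_cast; linarith
  set b : ℕ → ℝ := fun L => -sectorPressureTT' β t t' U n L with hb
  have hC : 0 ≤ β * (16 * |t| + 32 * |t'|) + β * U + 4 := by positivity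
  have hD : 0 ≤ 4 * β * (18 * (2 * |t| + U) + 36 * |t'|) / (2 - n) := by positivity
  obtain ⟨e, he⟩ := tendsto_of_tiling_of_filling b (C := β * (16 * |t| + 32 * |t'|) + β * U + 4)
    (D := 4 * β * (18 * (2 * |t| + U) + 36 * |t'|) / (2 - n)) (c := Real.log 4 + β * (8 * |t| + 8 * |t'|))
    hM₀1 hC hD
    (fun M hM => by
      have h := sectorPressureTT'_le_apriori hβ t t' hU hn0 hn2 (hM₀1.trans hM)
      simp only [hb]; linarith)
    (fun k M hM => by
      have h := sectorPressureTT'_le_tiling hβ t t' hU hn0 hn2 k (hM₀1.trans hM)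
      have hMpos : (0 : ℝ) < M := by exact_mod_cast hM₀1.trans hM
      have hextra : (β * (16 * |t| + 32 * |t'|) + 4) / (M : ℝ) ≤ (β * (16 * |t| + 32 * |t'|) + β * U + 4) / M :=
        div_le_div_of_nonneg_right (by nlinarith [mul_nonneg hβ hU]) hMpos.le
      simp only [hb]; linarith)
    (fun ℓ L hℓ hℓL => by
      have h := sq_mul_neg_sectorPressureTT'_le_filling hβ t t' hU hn0 hn2 hM₀1 hM₀n hℓ hℓL
      simp only [hb]; linarith)
  refine ⟨-e, ?_⟩
  have h := he.neg
  simp only [hb, neg_neg] at h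
  exact h

end Fekete

/-! ### §3 The thermal pressure as ONE number -/

/-- **The thermal pressure (free entropy per site) of the two-dimensional `t–t'` Hubbard model** at inverse
temperature `β`, couplings `(t, t', U)` and filling `n`:
`p(β; t,t',U; n) = lim_{L→∞} L⁻² log Z_β(sectorHamiltonianTT' t t' U n L)` — the thermodynamic limit along the tori
`ℤ/Lℤ × ℤ/Lℤ` of the canonical `(rectN n L, S^z = 0)` free entropy per site (`limUnder`; the limit exists for
`β ≥ 0`, `U ≥ 0`, `0 ≤ n < 2` by `exists_tendsto_sectorPressureTT'`; `= −β ×` the canonical free energy per site).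
The `T > 0` twin of `energyDensityTT'`. [cite: Israel1979, Thm. I.2.4] [cite: Ruelle1969, §3.4] -/
def pressureTT' (β t t' U n : ℝ) : ℝ :=
  limUnder atTop (fun L : ℕ => sectorPressureTT' β t t' U n L)

section Limit

variable {β : ℝ} (hβ : 0 ≤ β) (t t' : ℝ) {U : ℝ} (hU : 0 ≤ U) {n : ℝ} (hn0 : 0 ≤ n) (hn2 : n < 2)
include hβ hU hn0 hn2

/-- **The defining limit**: `p_L → p(β; t,t',U; n)` (`β ≥ 0`, `U ≥ 0`, `0 ≤ n < 2`). [cite: Israel1979, Thm. I.2.4] -/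
theorem tendsto_sectorPressureTT' :
    Tendsto (fun L : ℕ => sectorPressureTT' β t t' U n L) atTop (𝓝 (pressureTT' β t t' U n)) :=
  tendsto_nhds_limUnder (exists_tendsto_sectorPressureTT' hβ t t' hU hn0 hn2)

/-- The limit in the `log Z / L²` form along every side sequence `Ls → ∞` (the form the torus-limit readers use).
[cite: Israel1979, Thm. I.2.4] -/
theorem tendsto_log_partitionFn_div_sq_comp {Ls : ℕ → ℕ} (hLs : Tendsto Ls atTop atTop) :
    Tendsto (fun j => Real.log (partitionFn β (sectorHamiltonianTT' t t' U n (Ls j))).re / (Ls j : ℝ) ^ 2) atTop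
      (𝓝 (pressureTT' β t t' U n)) :=
  (tendsto_sectorPressureTT' hβ t t' hU hn0 hn2).comp hLs

/-- `p⁺ = p`. [cite: Israel1979, Thm. I.2.4] -/
theorem pressureSupTT'_eq_pressureTT' : pressureSupTT' β t t' U n = pressureTT' β t t' U n :=
  (tendsto_sectorPressureTT' hβ t t' hU hn0 hn2).limsup_eq

/-- `p⁻ = p`. [cite: Israel1979, Thm. I.2.4] -/
theorem pressureInfTT'_eq_pressureTT' : pressureInfTT' β t t' U n = pressureTT' β t t' U n :=
  (tendsto_sectorPressureTT' hβ t t' hU hn0 hn2).liminf_eq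

/-- **Pressure FLOORS are bounds on the number `p`**: `W ≤ p ↔ ∀ ε > 0, ∀ᶠ L, (W − ε) L² ≤ log Re Z_β^{sector}(L)`
(the `hW` certificate shape). [cite: Israel1979, Thm. I.2.4] -/
theorem le_pressureTT'_iff {W : ℝ} :
    W ≤ pressureTT' β t t' U n ↔ ∀ ε : ℝ, 0 < ε → ∀ᶠ L : ℕ in atTop,
      (W - ε) * (L : ℝ) ^ 2 ≤ Real.log (partitionFn β (sectorHamiltonianTT' t t' U n L)).re := by
  rw [← pressureInfTT'_eq_pressureTT' hβ t t' hU hn0 hn2]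
  exact le_pressureInfTT'_iff hβ t t' U hn0 hn2

/-- **Pressure CEILINGS are bounds on the number `p`**: `p ≤ u ↔ ∀ ε > 0, ∀ᶠ L, log Re Z_β^{sector}(L) ≤ (u + ε) L²`
(the `hu` certificate shape). [cite: Israel1979, Thm. I.2.4] -/
theorem pressureTT'_le_iff {u : ℝ} :
    pressureTT' β t t' U n ≤ u ↔ ∀ ε : ℝ, 0 < ε → ∀ᶠ L : ℕ in atTop,
      Real.log (partitionFn β (sectorHamiltonianTT' t t' U n L)).re ≤ (u + ε) * (L : ℝ) ^ 2 := by
  rw [← pressureSupTT'_eq_pressureTT' hβ t t' hU hn0 hn2]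
  exact pressureSupTT'_le_iff hβ t t' U hn0 hn2

/-- The `hW` shape along any `Ls → ∞` from a floor on the number. [cite: Israel1979, Thm. I.2.4] -/
theorem eventually_sub_mul_sq_le_log_partitionFn_of_le_pressureTT' {W : ℝ} (hW : W ≤ pressureTT' β t t' U n)
    {Ls : ℕ → ℕ} (hLs : Tendsto Ls atTop atTop) {ε : ℝ} (hε : 0 < ε) :
    ∀ᶠ j in atTop, (W - ε) * (Ls j : ℝ) ^ 2 ≤ Real.log (partitionFn β (sectorHamiltonianTT' t t' U n (Ls j))).re :=
  eventually_sub_mul_sq_le_log_partitionFn_of_le_pressureInfTT' hβ t t' U hn0 hn2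
    (by rwa [pressureInfTT'_eq_pressureTT' hβ t t' hU hn0 hn2]) hLs hε

/-- The `hu` shape along any `Ls → ∞` from a ceiling on the number. [cite: Israel1979, Thm. I.2.4] -/
theorem eventually_log_partitionFn_le_add_mul_sq_of_pressureTT'_le {u : ℝ} (hu : pressureTT' β t t' U n ≤ u)
    {Ls : ℕ → ℕ} (hLs : Tendsto Ls atTop atTop) {ε : ℝ} (hε : 0 < ε) :
    ∀ᶠ j in atTop, Real.log (partitionFn β (sectorHamiltonianTT' t t' U n (Ls j))).re ≤ (u + ε) * (Ls j : ℝ) ^ 2 :=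
  eventually_log_partitionFn_le_add_mul_sq_of_pressureSupTT'_le hβ t t' U hn0 hn2
    (by rwa [pressureSupTT'_eq_pressureTT' hβ t t' hU hn0 hn2]) hLs hε

/-- **The a-priori window**: `−β e(t,t',U,n) ≤ p(β; t,t',U; n) ≤ 2 H_b(n/2) − β e(t,t',U,n)`. [cite: Ruelle1969, §3.3] -/
theorem pressureTT'_mem_Icc :
    pressureTT' β t t' U n ∈ Set.Icc (-(β * energyDensityTT' t t' U n))
      (2 * Real.binEntropy (n / 2) - β * energyDensityTT' t t' U n) := by
  constructor
  · rw [← pressureInfTT'_eq_pressureTT' hβ t t' hU hn0 hn2]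
    exact neg_mul_energyDensityTT'_le_pressureInfTT' hβ t t' hU hn0 hn2
  · rw [← pressureSupTT'_eq_pressureTT' hβ t t' hU hn0 hn2]
    exact pressureSupTT'_le_two_mul_binEntropy_sub hβ t t' hU hn0 hn2

end Limit

/-- **Infinite temperature**: `p(0; t,t',U; n) = 2 H_b(n/2)` (`U ≥ 0`, `0 ≤ n < 2`). [cite: Israel1979, Lemma II.3.1] -/
theorem pressureTT'_zero (t t' : ℝ) {U : ℝ} (hU : 0 ≤ U) {n : ℝ} (hn0 : 0 ≤ n) (hn2 : n < 2) :
    pressureTT' 0 t t' U n = 2 * Real.binEntropy (n / 2) := by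
  rw [← pressureSupTT'_eq_pressureTT' le_rfl t t' hU hn0 hn2, pressureSupTT'_zero t t' U hn0 hn2.le]

/-- **Scale covariance**: `p(β; ct, ct', cU; n) = p(βc; t, t', U; n)` (`β, c ≥ 0`, `U ≥ 0`).
[cite: Ruelle1969, §3.3] -/
theorem pressureTT'_scale {β c : ℝ} (hβ : 0 ≤ β) (hc : 0 ≤ c) (t t' : ℝ) {U : ℝ} (hU : 0 ≤ U) {n : ℝ}
    (hn0 : 0 ≤ n) (hn2 : n < 2) :
    pressureTT' β (c * t) (c * t') (c * U) n = pressureTT' (β * c) t t' U n := by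
  rw [← pressureSupTT'_eq_pressureTT' hβ (c * t) (c * t') (mul_nonneg hc hU) hn0 hn2,
    ← pressureSupTT'_eq_pressureTT' (mul_nonneg hβ hc) t t' hU hn0 hn2, pressureSupTT'_scale]

end ThermodynamicLimit

/-! ### §4 Thermal energy windows and transport for the number -/

namespace InfVolFermionState

open ThermodynamicLimit

variable {t t' U n β : ℝ} {ω : InfVolFermionState 2} {Ls : ℕ → ℕ}

/-- **Hot chord with the number**: for every torus limit `ω` of the canonical sector Gibbs states at `β` along any
`Ls → ∞` (`U ≥ 0`, `0 ≤ n < 2`, `0 < β_h < β`): `e_{Φ(t,t',U)}(ω) ≤ (p(β_h) − p(β))/(β − β_h)`.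
[cite: Israel1979, Lemma II.3.1] -/
theorem IsTorusLimitOfMixture.meanEnergy_hubbardTTPrime_le_pressureTT'_chord (hU : 0 ≤ U) (hn0 : 0 ≤ n)
    (hn2 : n < 2)
    (h : ω.IsTorusLimitOfMixture (sectorGibbsCount n) (fun L => sectorGibbsWeightTT' β t t' U n L)
      (fun L => sectorGibbsVectorTT' t t' U n L) Ls)
    (hLs : Tendsto Ls atTop atTop) {βh : ℝ} (hβh : 0 < βh) (hlt : βh < β) :
    ω.meanEnergy (hubbardTTPrimeFermionInteraction t t' U) 1 ≤
      (pressureTT' βh t t' U n - pressureTT' β t t' U n) / (β - βh) := by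
  rw [← pressureSupTT'_eq_pressureTT' hβh.le t t' hU hn0 hn2,
    ← pressureInfTT'_eq_pressureTT' (hβh.trans hlt).le t t' hU hn0 hn2]
  exact h.meanEnergy_hubbardTTPrime_le_pressure_chord hn0 hn2 hLs hβh hlt

/-- **Cold chord with the number**: `(p(β) − p(β_c))/(β_c − β) ≤ e_{Φ(t,t',U)}(ω)` (`0 < β < β_c`).
[cite: Israel1979, Lemma II.3.1] -/
theorem IsTorusLimitOfMixture.pressureTT'_chord_le_meanEnergy_hubbardTTPrime (hU : 0 ≤ U) (hn0 : 0 ≤ n)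
    (hn2 : n < 2)
    (h : ω.IsTorusLimitOfMixture (sectorGibbsCount n) (fun L => sectorGibbsWeightTT' β t t' U n L)
      (fun L => sectorGibbsVectorTT' t t' U n L) Ls)
    (hLs : Tendsto Ls atTop atTop) {βc : ℝ} (hβ : 0 < β) (hlt : β < βc) :
    (pressureTT' β t t' U n - pressureTT' βc t t' U n) / (βc - β) ≤
      ω.meanEnergy (hubbardTTPrimeFermionInteraction t t' U) 1 := by
  rw [← pressureInfTT'_eq_pressureTT' hβ.le t t' hU hn0 hn2,
    ← pressureSupTT'_eq_pressureTT' (hβ.trans hlt).le t t' hU hn0 hn2]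
  exact h.pressure_chord_le_meanEnergy_hubbardTTPrime hn0 hn2 hLs hβ hlt

/-- **Infinite-temperature chord with the number**: `e_{Φ(t,t',U)}(ω) ≤ (2 H_b(n/2) − p(β))/β` (`β > 0`).
[cite: Israel1979, Lemma II.3.1] -/
theorem IsTorusLimitOfMixture.meanEnergy_hubbardTTPrime_le_binEntropy_sub_pressureTT'_div (hU : 0 ≤ U)
    (hn0 : 0 ≤ n) (hn2 : n < 2)
    (h : ω.IsTorusLimitOfMixture (sectorGibbsCount n) (fun L => sectorGibbsWeightTT' β t t' U n L)
      (fun L => sectorGibbsVectorTT' t t' U n L) Ls)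
    (hLs : Tendsto Ls atTop atTop) (hβ : 0 < β) :
    ω.meanEnergy (hubbardTTPrimeFermionInteraction t t' U) 1 ≤
      (2 * Real.binEntropy (n / 2) - pressureTT' β t t' U n) / β := by
  rw [← pressureInfTT'_eq_pressureTT' hβ.le t t' hU hn0 hn2]
  exact h.meanEnergy_hubbardTTPrime_le_binEntropy_sub_pressureInf_div hn0 hn2 hLs hβ

end InfVolFermionState

namespace ThermodynamicLimit

section Transport

variable {n : ℝ} (hn0 : 0 ≤ n) (hn2 : n < 2)
include hn0 hn2

/-- **β-staircase, floor step, for the number**: a thermal energy cap `e_Φ(ω) ≤ e⁺` on every torus limit at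
`b₀ ≥ 0` gives `p(b₀) − (b₁ − b₀) e⁺ ≤ p(b₁)` for every `b₁ ≥ b₀` (`U ≥ 0`). [cite: GustafsonSigal2003, §18.3] -/
theorem pressureTT'_sub_mul_le_pressureTT' (t t' : ℝ) {U : ℝ} (hU : 0 ≤ U) {b₀ b₁ : ℝ} (hb₀ : 0 ≤ b₀)
    (hb : b₀ ≤ b₁) {ecap : ℝ}
    (hcap : ∀ (ω : InfVolFermionState 2) (Ls : ℕ → ℕ), Tendsto Ls atTop atTop →
      ω.IsTorusLimitOfMixture (sectorGibbsCount n) (fun L => sectorGibbsWeightTT' b₀ t t' U n L)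
        (fun L => sectorGibbsVectorTT' t t' U n L) Ls →
      ω.meanEnergy (hubbardTTPrimeFermionInteraction t t' U) 1 ≤ ecap) :
    pressureTT' b₀ t t' U n - (b₁ - b₀) * ecap ≤ pressureTT' b₁ t t' U n := by
  rw [← pressureInfTT'_eq_pressureTT' hb₀ t t' hU hn0 hn2,
    ← pressureInfTT'_eq_pressureTT' (hb₀.trans hb) t t' hU hn0 hn2]
  exact pressureInfTT'_sub_mul_le_pressureInfTT' t t' U hn0 hn2 hb₀ hb hcap

/-- **β-staircase, ceiling step, for the number**: a thermal energy floor `e⁻ ≤ e_Φ(ω)` on every torus limit at `b₁`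
gives `p(b₁) ≤ p(b₀) − (b₁ − b₀) e⁻` for `0 ≤ b₀ ≤ b₁`. [cite: GustafsonSigal2003, §18.3] -/
theorem pressureTT'_le_pressureTT'_sub_mul (t t' : ℝ) {U : ℝ} (hU : 0 ≤ U) {b₀ b₁ : ℝ} (hb₀ : 0 ≤ b₀)
    (hb : b₀ ≤ b₁) {efl : ℝ}
    (hfloor : ∀ (ω : InfVolFermionState 2) (Ls : ℕ → ℕ), Tendsto Ls atTop atTop →
      ω.IsTorusLimitOfMixture (sectorGibbsCount n) (fun L => sectorGibbsWeightTT' b₁ t t' U n L)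
        (fun L => sectorGibbsVectorTT' t t' U n L) Ls →
      efl ≤ ω.meanEnergy (hubbardTTPrimeFermionInteraction t t' U) 1) :
    pressureTT' b₁ t t' U n ≤ pressureTT' b₀ t t' U n - (b₁ - b₀) * efl := by
  rw [← pressureSupTT'_eq_pressureTT' hb₀ t t' hU hn0 hn2,
    ← pressureSupTT'_eq_pressureTT' (hb₀.trans hb) t t' hU hn0 hn2]
  exact pressureSupTT'_le_pressureSupTT'_sub_mul t t' U hn0 hn2 hb₀ hb hfloor

/-- **Jensen CAP over a TEMPERATURE × COUPLING cell for the number** (all anchors and the target with `U ≥ 0`,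
`β ≥ 0`): corner ceilings `p(β_k; q_k) ≤ u_k` and `β • q = Σ w_k • (β_k • q_k)` give `p(β; q) ≤ Σ w_k u_k`.
[cite: Israel1979, Thm. I.2.4] [cite: Lieb1973, §V (5.2)–(5.4)] -/
theorem pressureTT'_le_sum {κ : Type*} (S : Finset κ) (w : κ → ℝ) (βk : κ → ℝ) (qk : κ → ℝ × ℝ × ℝ) (u : κ → ℝ)
    (hw : ∀ k ∈ S, 0 ≤ w k) (hw1 : ∑ k ∈ S, w k = 1) (hβk : ∀ k ∈ S, 0 ≤ βk k) (hUk : ∀ k ∈ S, 0 ≤ (qk k).2.2)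
    {β : ℝ} (hβ : 0 ≤ β) {q : ℝ × ℝ × ℝ} (hUq : 0 ≤ q.2.2) (hc : β • q = ∑ k ∈ S, w k • (βk k • qk k))
    (hu : ∀ k ∈ S, pressureTT' (βk k) (qk k).1 (qk k).2.1 (qk k).2.2 n ≤ u k) :
    pressureTT' β q.1 q.2.1 q.2.2 n ≤ ∑ k ∈ S, w k * u k := by
  rw [← pressureSupTT'_eq_pressureTT' hβ q.1 q.2.1 hUq hn0 hn2]
  exact pressureSupTT'_le_sum hn0 hn2 S w βk qk u hw hw1 hβk hβ hc fun k hk => by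
    rw [pressureSupTT'_eq_pressureTT' (hβk k hk) (qk k).1 (qk k).2.1 (hUk k hk) hn0 hn2]; exact hu k hk

/-- **JOINT CONVEXITY of the pressure in the β-scaled couplings** on the half-space `{U ≥ 0}`:
`(λ₁, λ₂, λ₃) ↦ p(1; λ₁, λ₂, λ₃; n)` is convex on `{λ₃ ≥ 0}`; with `p(β; t,t',U) = p(1; βt, βt', βU)`
(`pressureTT'_scale`) this is the convexity of the free entropy in `(βt, βt', βU)`. [cite: Israel1979, Thm. I.2.4] -/
theorem convexOn_pressureTT'_one :
    ConvexOn ℝ {q : ℝ × ℝ × ℝ | 0 ≤ q.2.2} (fun q : ℝ × ℝ × ℝ => pressureTT' 1 q.1 q.2.1 q.2.2 n) := by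
  have hset : Convex ℝ {q : ℝ × ℝ × ℝ | 0 ≤ q.2.2} := by
    intro x hx y hy a b ha hb _
    simp only [Set.mem_setOf_eq, Prod.snd_add, Prod.smul_snd, smul_eq_mul] at hx hy ⊢
    exact add_nonneg (mul_nonneg ha hx) (mul_nonneg hb hy)
  refine ((convexOn_pressureSupTT'_one hn0 hn2).subset (Set.subset_univ _) hset).congr fun q hq => ?_
  exact pressureSupTT'_eq_pressureTT' zero_le_one q.1 q.2.1 hq hn0 hn2

/-- **Convexity in `β`** at fixed couplings (`U ≥ 0`): `β ↦ p(β; t,t',U; n)` is convex on `[0, ∞)`.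
[cite: GustafsonSigal2003, §18.3] -/
theorem convexOn_pressureTT'_beta (t t' : ℝ) {U : ℝ} (hU : 0 ≤ U) :
    ConvexOn ℝ (Set.Ici 0) (fun β : ℝ => pressureTT' β t t' U n) :=
  (convexOn_pressureSupTT'_beta t t' U hn0 hn2).congr fun _ hβ =>
    pressureSupTT'_eq_pressureTT' (Set.mem_Ici.1 hβ) t t' hU hn0 hn2

/-- **`p` is antitone in `U`** on `[0, ∞)` (`β ≥ 0`): `0 ≤ U₁ ≤ U₂ ⇒ p(U₂) ≤ p(U₁)`. [cite: Israel1979, Thm. I.3.4] -/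
theorem pressureTT'_anti_U {β : ℝ} (hβ : 0 ≤ β) (t s : ℝ) {U₁ U₂ : ℝ} (hU₁ : 0 ≤ U₁) (hU : U₁ ≤ U₂) :
    pressureTT' β t s U₂ n ≤ pressureTT' β t s U₁ n := by
  rw [← pressureSupTT'_eq_pressureTT' hβ t s hU₁ hn0 hn2, ← pressureSupTT'_eq_pressureTT' hβ t s (hU₁.trans hU) hn0 hn2]
  exact pressureSupTT'_anti_U hβ t s hn0 hn2 hU

/-- **`U`-Lipschitz**: `|p(U₁) − p(U₂)| ≤ β (n/2) |U₁ − U₂|` for `U₁, U₂ ≥ 0`. [cite: Lieb1973, §V (5.2)–(5.4)] -/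
theorem abs_pressureTT'_sub_le_U {β : ℝ} (hβ : 0 ≤ β) (t s : ℝ) {U₁ U₂ : ℝ} (hU₁ : 0 ≤ U₁) (hU₂ : 0 ≤ U₂) :
    |pressureTT' β t s U₁ n - pressureTT' β t s U₂ n| ≤ β * (n / 2) * |U₁ - U₂| := by
  rw [← pressureSupTT'_eq_pressureTT' hβ t s hU₁ hn0 hn2, ← pressureSupTT'_eq_pressureTT' hβ t s hU₂ hn0 hn2]
  exact abs_pressureSupTT'_sub_le_U hβ t s hn0 hn2 U₁ U₂

/-- **`t'`-Lipschitz**: `|p(β;t,s₁,U) − p(β;t,s₂,U)| ≤ 4βn |s₁ − s₂|` (`U ≥ 0`). [cite: Lieb1973, §V (5.2)–(5.4)] -/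
theorem abs_pressureTT'_sub_le_tPrime {β : ℝ} (hβ : 0 ≤ β) (t : ℝ) {U : ℝ} (hU : 0 ≤ U) (s₁ s₂ : ℝ) :
    |pressureTT' β t s₁ U n - pressureTT' β t s₂ U n| ≤ 4 * β * n * |s₁ - s₂| := by
  rw [← pressureSupTT'_eq_pressureTT' hβ t s₁ hU hn0 hn2, ← pressureSupTT'_eq_pressureTT' hβ t s₂ hU hn0 hn2]
  exact abs_pressureSupTT'_sub_le_tPrime hβ t U hn0 hn2 s₁ s₂

end Transport

end ThermodynamicLimit

end Literature.MathematicalPhysics.QuantumLattice
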